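import Summits.HodgeConjecture.CorCM.MumfordTateRankProductRigidFactors
import Summits.HodgeConjecture.CorCM.MumfordTateRankCMCurveTimesThreefold
import Summits.HodgeConjecture.CorCM.MumfordTateRankRibetTypeOne
import Literature.AlgebraicGeometry.HodgeTheory.RankOneCentreTimesCMCurveInvariance
import Literature.AlgebraicGeometry.Motives.HodgeLieOfAbelianVarietyBiproduct
import HarnessLib

/-!
# `t(X₁ × X₂) ≥ t(X₁)` for a `Θ`-rigid factor `X₁`; Ribet type `(g − 1, 1)` is `Θ`-rigid; the cell CM curve × type-IV(2,1) threefold is `{10, 11}`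
# (Moonen–Zarhin 1999 §3 (3.1) «the projections `Hg(X₁ × X₂) → Hg(X_i)` are surjective»; Ribet 1983 Thm. 3)

COR-CM (cell `pub-hodgecm2`, seat `b27` gen 48, count-neutral Mumford–Tate-rank ladder; theorems only, no definition, no named fact;
UNCONDITIONAL — nothing here uses or asserts HC_CM).  MONOTONICITY of the Mumford–Tate rank along a product, `t(X₁ × X₂) ≥ t(X₁)`, is the
dimension shadow of Moonen–Zarhin's «the projection `Hg(X₁ × X₂) → Hg(X₁)` is surjective» — a statement about `ℚ`-algebraic groups (the
minimality of `Hg`).  For the tree's `hodgeLie` (the annihilator of all Hodge tensors) the projection `X ↦ π₁ X ι₁` is onto as soon as the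
factor `X₁` is `Θ`-RIGID (`Motives/HodgeLieProductSimpleFactor`, `hodgeLie_eq_map_restrict_of_rigid`), whence `dim Lie Hg(H¹X₁) ≤
dim Lie Hg(H¹(X₁ × X₂))` with NO hypothesis on `X₂`.

* §1 **`finrank_hodgeLie_hodge_one_le_prod_of_rigid`**, **`mtRank_hodge_one_le_of_isIsogenous_prod_of_rigid`** — `X₁` `Θ`-rigid ⟹
  `dim Lie Hg(H¹X₁) ≤ dim Lie Hg(H¹(X₁ × X₂))` and `t(X₁) ≤ t(X)` for every `X ∼ X₁ × X₂` (any `X₂`).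
* §2 **`hodgeLie_rigid_of_ribetTypeOne`** — RIBET TYPE `(g − 1, 1)` IS `Θ`-RIGID: `dim A = g ≥ 3`, `dim_ℚ End⁰A = 2`, `φ ∘ φ = −d`, multiplicity one at
  `i√d` or `−i√d` on `H^{1,0}(A)` — the tree's unitary `Θ`-subalgebra theorem `UnitaryTheta.eq_hodgeLie` (`Lie Hg(H¹A) = 𝔲_K(H¹A, ψ)` is generated by
  the Galois conjugates of `Θ`); in particular every simple abelian threefold with `dim_ℚ End⁰ = 2`
  (`hodgeLie_rigid_of_isSimple_threefold_of_finrank_endAlgebra_eq_two`).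
* §3 the fourfold cell **CM elliptic curve × simple type-IV(2,1) threefold: `t ∈ {10, 11}`** for ALL pairs of fields
  (`mtRank_hodge_one_mem_of_isIsogenous_cmCurve_prod_isSimple_threefold_of_finrank_eq_two`: `10 = t(T) ≤ t ≤ t(T) + t(E) − 1 = 11`), `= 11`
  when `End⁰E ↛ End⁰T` (`CorCM/MumfordTateRankTimesCMCurve`); Moonen–Zarhin: `= 10` exactly in the same-field case (Thm. 0.1 (4)(a), the
  exceptional Hodge classes in `H¹(E) ⊗ ∧³H¹(T)` — not constructed here).  Also `t(A × T) ≥ 10` for every `A` and such a `T`.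

## References
* [MoonenZarhin1999LowDim] B. Moonen, Yu. G. Zarhin, *Hodge classes on abelian varieties of low dimension*, Math. Ann. 315 (1999), §3 (3.1),
  Prop. (3.8), §2 (2.3), Thm. 0.1 (4) [corpus: paper:arxiv-math_9901113 pp. 1, 5–7]. [cite: MoonenZarhin1999LowDim, §3 (3.1)]
* [Deligne1982HodgeCycles] P. Deligne, LNM 900 (1982), I §3.1 and Prop. 3.4. [cite: Deligne1982HodgeCycles, I §3.1 and Prop. 3.4]
* [Ribet1983] K. A. Ribet, Amer. J. Math. 105 (1983), Thm. 3. [cite: Ribet1983, Thm. 3]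
-/

noncomputable section

open scoped TensorProduct
open CategoryTheory CategoryTheory.Limits Module

namespace Summit.HodgeConjecture.CorCM

open Literature.AlgebraicGeometry.Motives
open Literature.AlgebraicGeometry.Motives.AbelianVariety
open Literature.AlgebraicGeometry.Motives.HodgeStructure
open Literature.AlgebraicGeometry.HodgeTheory
open Literature.AlgebraicGeometry.ComplexMultiplication
open Literature.AlgebraicGeometry.Milne1999 (IsOfCMType)

variable [HodgeTensorFacts.{0, 0}] {X X₁ X₂ A : AbelianVariety ℂ} {n n₁ n₂ : ℕ}

/-! ## §1 Monotonicity along a rigid factor -/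

/-- **`dim Lie Hg(H¹X₁) ≤ dim Lie Hg(H¹(X₁ × X₂))` for a `Θ`-rigid factor `X₁`** (any `X₂`): the restriction `X ↦ π₁ X ι₁` maps `Lie Hg(H¹(X₁ × X₂))`
ONTO `Lie Hg(H¹X₁)` (`hodgeLie_eq_map_restrict_of_rigid` on the bicone `fst`, `prodLift 𝟙 0`), and the dimension of an image does not exceed
that of the source.  (Moonen–Zarhin (3.1): the projections `Hg(X₁ × X₂) → Hg(X_i)` are surjective.) [cite: MoonenZarhin1999LowDim, §3 (3.1)]
[cite: Deligne1982HodgeCycles, I §3.1 and Prop. 3.4] -/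
theorem finrank_hodgeLie_hodge_one_le_prod_of_rigid (hX₁ : IsSmoothProjective n₁ X₁.X) {m : ℕ} (hP : IsSmoothProjective m (X₁.prod X₂).X)
    (hrig₁ : haveI := BettiUniverse.finite hX₁ 1
      ∀ 𝔞 : Submodule ℚ (Module.End ℚ (bettiCohomology X₁.X 1)),
        𝔞 ≤ (BettiUniverse.hodge exists_isReal_hodgeModel_holds hX₁ 1).hodgeLie →
        (∀ A ∈ 𝔞, ∀ B ∈ 𝔞, A * B - B * A ∈ 𝔞) →
        (∃ Θ ∈ Submodule.span ℂ ((fun A : Module.End ℚ (bettiCohomology X₁.X 1) => A.baseChange ℂ) ''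
            (𝔞 : Set (Module.End ℚ (bettiCohomology X₁.X 1)))),
          ∀ p, ∀ x ∈ (BettiUniverse.hodge exists_isReal_hodgeModel_holds hX₁ 1).piece p (((1 : ℕ) : ℤ) - p),
            Θ x = ((2 * p - ((1 : ℕ) : ℤ) : ℤ) : ℂ) • x) →
        (BettiUniverse.hodge exists_isReal_hodgeModel_holds hX₁ 1).hodgeLie ≤ 𝔞) :
    haveI := BettiUniverse.finite hP 1
    haveI := BettiUniverse.finite hX₁ 1
    Module.finrank ℚ (BettiUniverse.hodge exists_isReal_hodgeModel_holds hX₁ 1).hodgeLie ≤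
      Module.finrank ℚ (BettiUniverse.hodge exists_isReal_hodgeModel_holds hP 1).hodgeLie := by
  haveI := BettiUniverse.finite hP 1
  haveI := BettiUniverse.finite hX₁ 1
  let ι₁ := BettiUniverse.pullHodgeHom exists_isReal_hodgeModel_holds hodgePQ_independent_of_hodgeModel_holds hP hX₁
    (fst X₁ X₂).hom.hom.hom 1
  let π₁ := BettiUniverse.pullHodgeHom exists_isReal_hodgeModel_holds hodgePQ_independent_of_hodgeModel_holds hX₁ hP
    (prodLift (𝟙 X₁) (0 : X₁ ⟶ X₂)).hom.hom.hom 1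
  have hπι₁ : ∀ v, π₁.toLinearMap (ι₁.toLinearMap v) = v := fun v => pull_pull_eq_self_of_comp_eq_id (prodLift_fst _ _) v
  rw [hodgeLie_eq_map_restrict_of_rigid ι₁ π₁ hπι₁ hrig₁]
  exact Submodule.finrank_map_le _ _

/-- **`t(X₁) ≤ t(X)` for `X ∼ X₁ × X₂` with `X₁` `Θ`-rigid** (`t = dim MT(H¹·) = dim Lie Hg + 1`, isogeny invariance).  E.g. `X₁` a non-CM elliptic curve or
QM surface, a surface with `End⁰ = ℚ`, a simple RM surface (`CorCM/MumfordTateRankProductRigidFactors`), or of Ribet type `(g − 1, 1)` (§2).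
[cite: MoonenZarhin1999LowDim, §3 (3.1)] -/
theorem mtRank_hodge_one_le_of_isIsogenous_prod_of_rigid (hX : IsSmoothProjective n X.X) (hX₁ : IsSmoothProjective n₁ X₁.X) (h₁ : 0 < X₁.dim)
    (hrig₁ : haveI := BettiUniverse.finite hX₁ 1
      ∀ 𝔞 : Submodule ℚ (Module.End ℚ (bettiCohomology X₁.X 1)),
        𝔞 ≤ (BettiUniverse.hodge exists_isReal_hodgeModel_holds hX₁ 1).hodgeLie →
        (∀ A ∈ 𝔞, ∀ B ∈ 𝔞, A * B - B * A ∈ 𝔞) →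
        (∃ Θ ∈ Submodule.span ℂ ((fun A : Module.End ℚ (bettiCohomology X₁.X 1) => A.baseChange ℂ) ''
            (𝔞 : Set (Module.End ℚ (bettiCohomology X₁.X 1)))),
          ∀ p, ∀ x ∈ (BettiUniverse.hodge exists_isReal_hodgeModel_holds hX₁ 1).piece p (((1 : ℕ) : ℤ) - p),
            Θ x = ((2 * p - ((1 : ℕ) : ℤ) : ℤ) : ℂ) • x) →
        (BettiUniverse.hodge exists_isReal_hodgeModel_holds hX₁ 1).hodgeLie ≤ 𝔞)
    (hXP : IsIsogenous X (X₁.prod X₂)) :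
    haveI := BettiUniverse.finite hX 1
    haveI := BettiUniverse.finite hX₁ 1
    (BettiUniverse.hodge exists_isReal_hodgeModel_holds hX₁ 1).mtRank ≤ (BettiUniverse.hodge exists_isReal_hodgeModel_holds hX 1).mtRank := by
  haveI := BettiUniverse.finite hX 1
  haveI := BettiUniverse.finite hX₁ 1
  have hP : IsSmoothProjective (X₁.prod X₂).dim (X₁.prod X₂).X := AbelianVariety.isSmoothProjective_holds
  haveI := BettiUniverse.finite hP 1
  have h0 : 0 < X.dim := by
    obtain ⟨f, hf⟩ := hXP
    rw [dim_eq_of_isIsogeny hf, dim_prod]; omega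
  have h := finrank_hodgeLie_hodge_one_le_prod_of_rigid (X₂ := X₂) hX₁ hP hrig₁
  rw [← finrank_hodgeLie_hodge_one_eq_of_isIsogenous hX hP hXP] at h
  rw [mtRank_hodge_one_eq_finrank_hodgeLie_add_one hX h0, mtRank_hodge_one_eq_finrank_hodgeLie_add_one hX₁ h₁]
  omega

/-! ## §2 Ribet type `(g − 1, 1)` is `Θ`-rigid -/

/-- **An abelian variety of Ribet type `(g − 1, 1)` is `Θ`-rigid**: `dim A ≥ 3`, `dim_ℚ End⁰A = 2`, `φ ∘ φ = −d` (`d > 0`) with multiplicity one at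
`i√d` or at `−i√d` on `H^{1,0}(A)` ⟹ every bracket-closed rational subspace of `Lie Hg(H¹A)` whose complex span contains a Hodge operator is all
of `Lie Hg(H¹A) = 𝔲_K(H¹A, ψ)` — the tree's `UnitaryTheta.eq_hodgeLie` (Ribet's Thm. 3 / Moonen–Zarhin (2.3) Type IV(1,1), Lie step; such a
subspace commutes with `End_Hdg = ℚ + ℚφ^*` and is `ψ`-skew because `Lie Hg` does and is). [cite: Ribet1983, Thm. 3] [cite: MoonenZarhin1999LowDim, §2 (2.3)]
[cite: Deligne1982HodgeCycles, I §3.1 and Prop. 3.4] -/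
theorem hodgeLie_rigid_of_ribetTypeOne (hA : IsSmoothProjective n A.X) (φ : A ⟶ A) {d : ℕ} (hd : 0 < d) (hφ : φ ≫ φ = -(d • 𝟙 A))
    (hE2 : Module.finrank ℚ A.endAlgebra = 2)
    (h1 : eigenMultiplicity A φ (Complex.I * (Real.sqrt d : ℂ)) = 1 ∨ eigenMultiplicity A φ (-(Complex.I * (Real.sqrt d : ℂ))) = 1)
    (hdim : 3 ≤ A.dim) :
    haveI := BettiUniverse.finite hA 1
    ∀ 𝔞 : Submodule ℚ (Module.End ℚ (bettiCohomology A.X 1)),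
      𝔞 ≤ (BettiUniverse.hodge exists_isReal_hodgeModel_holds hA 1).hodgeLie →
      (∀ B ∈ 𝔞, ∀ B' ∈ 𝔞, B * B' - B' * B ∈ 𝔞) →
      (∃ Θ ∈ Submodule.span ℂ ((fun B : Module.End ℚ (bettiCohomology A.X 1) => B.baseChange ℂ) ''
          (𝔞 : Set (Module.End ℚ (bettiCohomology A.X 1)))),
        ∀ p, ∀ x ∈ (BettiUniverse.hodge exists_isReal_hodgeModel_holds hA 1).piece p (((1 : ℕ) : ℤ) - p),
          Θ x = ((2 * p - ((1 : ℕ) : ℤ) : ℤ) : ℂ) • x) →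
      (BettiUniverse.hodge exists_isReal_hodgeModel_holds hA 1).hodgeLie ≤ 𝔞 := by
  classical
  have hnA : A.dim = n := schemeDim_eq_holds hA
  subst hnA
  haveI := BettiUniverse.finite hA 1
  obtain ⟨ψ⟩ := BettiUniverse.hodge_isPolarizable exists_isReal_hodgeModel_holds hA 1
  have heff := BettiUniverse.hodge_isEffective exists_isReal_hodgeModel_holds hA 1
  set φQ : Module.End ℚ (bettiCohomology A.X 1) := (bettiCohomology.map φ.hom.hom.hom 1).hom with hφQ
  have hφE : φQ ∈ (BettiUniverse.hodge exists_isReal_hodgeModel_holds hA 1).endAlg :=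
    pullback_mem_endAlg exists_isReal_hodgeModel_holds hodgePQ_independent_of_hodgeModel_holds φ
  have hφ2 : φQ * φQ = -((d : ℚ) • 1) := bettiMapHom_mul_self hφ
  have hdQ : (0 : ℚ) < d := Nat.cast_pos.2 hd
  have hE := exists_eq_smul_one_add_smul_bettiMapHom exists_isReal_hodgeModel_holds hodgePQ_independent_of_hodgeModel_holds hd hφ hE2
    (by omega)
  have hsum := eigenMultiplicity_add_eigenMultiplicity_neg_eq_dim A φ hd hφ
  have hμ₀ : (Complex.I * (Real.sqrt d : ℂ)) ^ 2 = -((d : ℚ) : ℂ) := by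
    rw [mul_pow, Complex.I_sq, ← Complex.ofReal_pow, Real.sq_sqrt (Nat.cast_nonneg d), Complex.ofReal_natCast,
      Rat.cast_natCast, neg_one_mul]
  have hconj₀ : starRingEnd ℂ (Complex.I * (Real.sqrt d : ℂ)) = -(Complex.I * (Real.sqrt d : ℂ)) := by
    rw [map_mul, Complex.conj_I, Complex.conj_ofReal, neg_mul]
  obtain ⟨μ, hμ, hm1, hm2⟩ : ∃ μ : ℂ, μ ^ 2 = -((d : ℚ) : ℂ) ∧
      eigenMultiplicity A φ (starRingEnd ℂ μ) = 1 ∧ 2 ≤ eigenMultiplicity A φ μ := by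
    rcases h1 with h | h
    · exact ⟨-(Complex.I * (Real.sqrt d : ℂ)), by rw [neg_sq, hμ₀], by rw [map_neg, hconj₀, neg_neg, h], by omega⟩
    · exact ⟨Complex.I * (Real.sqrt d : ℂ), hμ₀, by rw [hconj₀, h], by omega⟩
  have h1' : Module.finrank ℂ ↥(Module.End.eigenspace (φQ.baseChange ℂ) μ ⊓
      (BettiUniverse.hodge exists_isReal_hodgeModel_holds hA 1).piece 0 1) = 1 := by
    rw [hφQ, finrank_eigenspace_inf_piece_zeroOne_eq_eigenMultiplicity_conj exists_isReal_hodgeModel_holds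
      hodgePQ_independent_of_hodgeModel_holds φ μ, hm1]
  have h2' : 2 ≤ Module.finrank ℂ ↥(Module.End.eigenspace (φQ.baseChange ℂ) μ ⊓
      (BettiUniverse.hodge exists_isReal_hodgeModel_holds hA 1).piece 1 0) := by
    rw [hφQ, finrank_eigenspace_inf_piece_oneZero_eq_eigenMultiplicity exists_isReal_hodgeModel_holds
      hodgePQ_independent_of_hodgeModel_holds φ μ]
    exact hm2
  intro 𝔞 hle hbr hΘ
  obtain ⟨Θ, hΘ𝔞, hΘ⟩ := hΘ
  rw [← UnitaryTheta.eq_hodgeLie _ Nat.cast_one heff ψ hφE hdQ hφ2 hE hμ h1' h2' 𝔞 hbr hΘ hΘ𝔞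
    (fun B hB a => commute_of_mem_hodgeLie _ (hle hB) a) (fun B hB => form_apply_add_eq_zero_of_mem_hodgeLie ψ (hle hB))]

/-- **A simple abelian threefold with `dim_ℚ End⁰T = 2` is `Θ`-rigid** (type IV(1,1): `End⁰T = ℚ(√−d)`, multiplicities `(2, 1)` by Shimura's
Prop. 14, `Lie Hg(H¹T) = 𝔲(2,1)`-form). [cite: MoonenZarhin1999LowDim, §2 (2.3) and (2.5)] [cite: Ribet1983, Thm. 3] -/
theorem hodgeLie_rigid_of_isSimple_threefold_of_finrank_endAlgebra_eq_two (hT : IsSmoothProjective n A.X) (hTs : A.IsSimple) (hT3 : A.dim = 3)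
    (hTE : Module.finrank ℚ A.endAlgebra = 2) :
    haveI := BettiUniverse.finite hT 1
    ∀ 𝔞 : Submodule ℚ (Module.End ℚ (bettiCohomology A.X 1)),
      𝔞 ≤ (BettiUniverse.hodge exists_isReal_hodgeModel_holds hT 1).hodgeLie →
      (∀ B ∈ 𝔞, ∀ B' ∈ 𝔞, B * B' - B' * B ∈ 𝔞) →
      (∃ Θ ∈ Submodule.span ℂ ((fun B : Module.End ℚ (bettiCohomology A.X 1) => B.baseChange ℂ) ''
          (𝔞 : Set (Module.End ℚ (bettiCohomology A.X 1)))),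
        ∀ p, ∀ x ∈ (BettiUniverse.hodge exists_isReal_hodgeModel_holds hT 1).piece p (((1 : ℕ) : ℤ) - p),
          Θ x = ((2 * p - ((1 : ℕ) : ℤ) : ℤ) : ℂ) • x) →
      (BettiUniverse.hodge exists_isReal_hodgeModel_holds hT 1).hodgeLie ≤ 𝔞 := by
  classical
  have h0 : 0 < A.dim := by omega
  have hF : IsField A.endAlgebra := AbelianVariety.isField_endAlgebra_of_isSimple_of_finrank_eq_two hTs h0 hTE
  have hnR : ¬ NumberField.IsTotallyReal (EndField A hF) := fun hR => by
    have h := finrank_endAlgebra_dvd_dim_of_isField_of_isTotallyReal hF h0 hR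
    rw [hTE, hT3] at h
    omega
  obtain ⟨a, q, hq, ha⟩ := AbelianVariety.exists_mul_self_eq_neg_of_finrank_eq_two h0 hTE hF hnR
  obtain ⟨φ, d, hd, hφ⟩ := AbelianVariety.exists_hom_comp_self_eq_neg A hq ha
  have hsum := eigenMultiplicity_add_eigenMultiplicity_neg_eq_dim A φ hd hφ
  have hpos := AbelianVariety.eigenMultiplicity_pos_of_isSimple A hTs φ hd hφ (by omega)
  have h1 : eigenMultiplicity A φ (Complex.I * (Real.sqrt d : ℂ)) = 1 ∨
      eigenMultiplicity A φ (-(Complex.I * (Real.sqrt d : ℂ))) = 1 := by omega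
  exact hodgeLie_rigid_of_ribetTypeOne hT φ hd hφ hTE h1 (by omega)

/-! ## §3 The fourfold cell: CM elliptic curve × simple type-IV(2,1) threefold -/

/-- **`t(A × T) ≥ 10` for every `A` and every simple abelian threefold `T` with `dim_ℚ End⁰T = 2`** (`t(T) = 10`, `T` is `Θ`-rigid).
[cite: MoonenZarhin1999LowDim, §3 (3.1) and §2 (2.3)] -/
theorem ten_le_mtRank_hodge_one_of_isIsogenous_prod_isSimple_threefold_of_finrank_eq_two (hX : IsSmoothProjective n X.X)
    {T : AbelianVariety ℂ} (hTs : T.IsSimple) (hT3 : T.dim = 3) (hTE : Module.finrank ℚ T.endAlgebra = 2) (hXP : IsIsogenous X (A.prod T)) :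
    haveI := BettiUniverse.finite hX 1
    10 ≤ (BettiUniverse.hodge exists_isReal_hodgeModel_holds hX 1).mtRank := by
  have hT : IsSmoothProjective T.dim T.X := AbelianVariety.isSmoothProjective_holds
  haveI := BettiUniverse.finite hX 1
  haveI := BettiUniverse.finite hT 1
  have h10 : (BettiUniverse.hodge exists_isReal_hodgeModel_holds hT 1).mtRank = 10 :=
    (mtRank_hodge_one_of_isSimple_threefold_of_finrank_endAlgebra_eq_two hT hTs hT3 hTE).1
  have h := mtRank_hodge_one_le_of_isIsogenous_prod_of_rigid (X₂ := A) hX hT (by omega)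
    (hodgeLie_rigid_of_isSimple_threefold_of_finrank_endAlgebra_eq_two hT hTs hT3 hTE) (hXP.trans (isIsogenous_prod_comm A T))
  omega

/-- **CM elliptic curve × SIMPLE abelian THREEFOLD with `dim_ℚ End⁰T = 2`: `t ∈ {10, 11}`** for every pair of fields (`10 = t(T) ≤ t ≤ t(T) + t(E) − 1
= 11`); `t = 11` when `End⁰E` does not embed into `End⁰T` (`CorCM/MumfordTateRankTimesCMCurve`), and Moonen–Zarhin's exceptional classes give `t = 10`
exactly in the same-field case (Thm. 0.1 (4)(a); not constructed in the tree). [cite: MoonenZarhin1999LowDim, §3 Prop. (3.8) and §2 (2.3)] -/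
theorem mtRank_hodge_one_mem_of_isIsogenous_cmCurve_prod_isSimple_threefold_of_finrank_eq_two (hX : IsSmoothProjective n X.X)
    {E T : AbelianVariety ℂ} (hE1 : E.dim = 1) (hEcm : IsOfCMType E) (hTs : T.IsSimple) (hT3 : T.dim = 3)
    (hTE : Module.finrank ℚ T.endAlgebra = 2) (hXP : IsIsogenous X (E.prod T)) :
    haveI := BettiUniverse.finite hX 1
    (BettiUniverse.hodge exists_isReal_hodgeModel_holds hX 1).mtRank = 10 ∨ (BettiUniverse.hodge exists_isReal_hodgeModel_holds hX 1).mtRank = 11 := by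
  haveI := BettiUniverse.finite hX 1
  have hle := mtRank_hodge_one_le_eleven_of_isIsogenous_cmCurve_prod_isSimple_threefold_of_finrank_eq_two hX hE1 hEcm hTs hT3 hTE hXP
  have hge := ten_le_mtRank_hodge_one_of_isIsogenous_prod_isSimple_threefold_of_finrank_eq_two (A := E) hX hTs hT3 hTE hXP
  omega

end Summit.HodgeConjecture.CorCM

end
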